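import Mathlib.Data.Finset.Card
import Mathlib.Data.Finset.SymmDiff
import Mathlib.Algebra.BigOperators.Group.Finset.Basic
import Mathlib.Algebra.BigOperators.Ring.Finset
import Mathlib.Data.ZMod.Basic
import Literature.Computability.MetaComplexity.ResLin
import Literature.Computability.MetaComplexity.ResLinProofs
import Literature.Computability.MetaComplexity.RevResLin
import HarnessLib

/-!
# One equation for the resolvent: the `𝔽₂` bookkeeping of the Res(⊕) space–width relation

Semantic lemmas on linear literals / linear clauses over `𝔽₂` (`LinLit`, `LinClause` of
`ResLin.lean`) used by the space–width relation for Res(⊕)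
(`Literature/Computability/MetaComplexity/ResLinSpaceWidth.lean`, Gryaznov–Ovcharov–Riazanov,
ACM ToCT 2024, §4):

* parity arithmetic: `linLit_eval_eq_true_iff_sum` (a literal `(f = b)` holds iff the `ZMod 2`-sum
  of `σ` over `f` is `b`), `linLit_eval_not`, `linLit_eval_symmDiff` (the SUM of two equations
  `(f = a) + (g = b) = (f ∆ g = a ⊕ b)` holds at common solutions), `linLit_eval_xor3_eq_false` /
  `linClause_eval_xor3_eq_false` (falsifying sets of linear clauses are closed under pointwise XOR
  of three assignments — they are affine subspaces of `𝔽₂ⁿ`);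
* `exists_imp_resolvent_of_imp` — THREE CANDIDATES: if the equation `e₁` implies the linear clause
  `C ∨ (f = 0)` and `e₂` implies `D ∨ (f = 1)`, then one of `e₁`, `e₂`, `e₁ + e₂` implies the
  resolvent `C ∨ D`. This is what lets the invariant of [GOR 2024, Lemma 9] ("the tracked system
  contains a LITERAL of every clause in memory") be replaced by "the tracked system contains an
  EQUATION IMPLYING every clause in memory", which survives the semantic weakening rule for free.

## References

* S. Gryaznov, S. Ovcharov, A. Riazanov, *Resolution over linear equations: combinatorial games
  for tree-like size and space*, ACM ToCT 16(3) (2024), §4, Lemma 9 [GryaznovOvcharovRiazanov2024].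
* D. Itsykson, D. Sokolov, *Resolution over linear equations modulo two*, Ann. Pure Appl. Logic
  171 (2020), §2 (semantics of linear clauses) [ItsyksonSokolov2020].
-/

namespace Literature.Computability.MetaComplexity

open _root_.Computability Complexity Finset

/-! ### Parity arithmetic for linear literals -/

/-- The parity of `σ` on the form `f`, as an element of `ZMod 2`, is the sum of the indicator of
`σ` over `f`. [folklore] -/
private theorem card_filter_eq_sum (σ : ℕ → Bool) (f : Finset ℕ) :
    (((f.filter fun i => σ i = true).card : ℕ) : ZMod 2) =
      ∑ i ∈ f, (if σ i = true then (1 : ZMod 2) else 0) := by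
  rw [Finset.sum_boole]

/-- A linear literal `(f = b)` is TRUE at `σ` iff the parity of `σ` on `f` is `b`. [Itsykson–Sokolov
2020, §2] [cite: ItsyksonSokolov2020, §2] -/
theorem linLit_eval_eq_true_iff_sum (σ : ℕ → Bool) (f : Finset ℕ) (b : Bool) :
    LinLit.eval σ (f, b) = true ↔
      ∑ i ∈ f, (if σ i = true then (1 : ZMod 2) else 0) = (if b = true then 1 else 0) := by
  rw [← card_filter_eq_sum, LinLit.eval]
  simp only [decide_eq_true_eq]
  set n := (f.filter fun i => σ i = true).card with hn
  rcases Nat.mod_two_eq_zero_or_one n with h | h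
  · have hn0 : (n : ZMod 2) = 0 := by
      rw [← ZMod.natCast_mod n 2, h, Nat.cast_zero]
    rw [h, hn0]
    cases b <;> decide
  · have hn1 : (n : ZMod 2) = 1 := by
      rw [← ZMod.natCast_mod n 2, h, Nat.cast_one]
    rw [h, hn1]
    cases b <;> decide

/-- Negating the constant negates the literal: `(f = ¬b)` is true iff `(f = b)` is false.
[Itsykson–Sokolov 2020, §2] [cite: ItsyksonSokolov2020, §2] -/
theorem linLit_eval_not (σ : ℕ → Bool) (f : Finset ℕ) (b : Bool) :
    LinLit.eval σ (f, !b) = !LinLit.eval σ (f, b) := by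
  cases b
  · exact LinLit.eval_true_eq_not σ f
  · have h := LinLit.eval_true_eq_not σ f
    simp only [Bool.not_true]
    rw [h, Bool.not_not]

/-- A linear clause is false at `σ` iff all its literals are (helper; cf. `TseitinLiftProofs`).
[Itsykson–Sokolov 2020, §2] [cite: ItsyksonSokolov2020, §2] -/
private theorem linClause_eval_eq_false_iff' (σ : ℕ → Bool) (C : LinClause) :
    C.eval σ = false ↔ ∀ l ∈ C, LinLit.eval σ l = false := by
  unfold LinClause.eval
  simp only [decide_eq_false_iff_not, not_exists, not_and, Bool.not_eq_true]

/-- The SUM of two equations `(f = a) + (g = b) = (f ∆ g = a ⊕ b)` (forms over `𝔽₂` add as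
symmetric differences of supports) holds at every common solution. [folklore] -/
theorem linLit_eval_symmDiff (σ : ℕ → Bool) (f g : Finset ℕ) (a b : Bool)
    (hf : LinLit.eval σ (f, a) = true) (hg : LinLit.eval σ (g, b) = true) :
    LinLit.eval σ (symmDiff f g, xor a b) = true := by
  rw [linLit_eval_eq_true_iff_sum] at hf hg ⊢
  set w : ℕ → ZMod 2 := fun i => if σ i = true then (1 : ZMod 2) else 0 with hw
  have hsd : ∑ i ∈ symmDiff f g, w i = ∑ i ∈ f, w i + ∑ i ∈ g, w i := by
    have h1 : ∑ i ∈ f, w i = ∑ i ∈ f \ g, w i + ∑ i ∈ f ∩ g, w i := by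
      rw [← Finset.sum_union (Finset.disjoint_sdiff_inter f g), Finset.sdiff_union_inter]
    have h2 : ∑ i ∈ g, w i = ∑ i ∈ g \ f, w i + ∑ i ∈ f ∩ g, w i := by
      rw [Finset.inter_comm, ← Finset.sum_union (Finset.disjoint_sdiff_inter g f),
        Finset.sdiff_union_inter]
    have h3 : ∑ i ∈ symmDiff f g, w i = ∑ i ∈ f \ g, w i + ∑ i ∈ g \ f, w i := by
      rw [Finset.symmDiff_def, Finset.sum_union disjoint_sdiff_sdiff]
    have h4 : ∀ x : ZMod 2, x + x = 0 := by decide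
    rw [h1, h2, h3]
    calc ∑ i ∈ f \ g, w i + ∑ i ∈ g \ f, w i
        = ∑ i ∈ f \ g, w i + ∑ i ∈ g \ f, w i + (∑ i ∈ f ∩ g, w i + ∑ i ∈ f ∩ g, w i) := by
          rw [h4, add_zero]
      _ = ∑ i ∈ f \ g, w i + ∑ i ∈ f ∩ g, w i + (∑ i ∈ g \ f, w i + ∑ i ∈ f ∩ g, w i) := by ring
  rw [hsd, hf, hg]
  cases a <;> cases b <;> decide

/-- Parity of a POINTWISE XOR OF THREE assignments: `⟨f, x ⊕ y ⊕ z⟩ = ⟨f, x⟩ + ⟨f, y⟩ + ⟨f, z⟩`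
(an affine combination of three points of `𝔽₂ⁿ` is again a point). [folklore] -/
private theorem sum_xor3 (x y z : ℕ → Bool) (f : Finset ℕ) :
    ∑ i ∈ f, (if (xor (xor (x i) (y i)) (z i)) = true then (1 : ZMod 2) else 0) =
      ∑ i ∈ f, (if x i = true then (1 : ZMod 2) else 0) +
        ∑ i ∈ f, (if y i = true then (1 : ZMod 2) else 0) +
        ∑ i ∈ f, (if z i = true then (1 : ZMod 2) else 0) := by
  rw [← Finset.sum_add_distrib, ← Finset.sum_add_distrib]
  refine Finset.sum_congr rfl fun i _ => ?_
  cases x i <;> cases y i <;> cases z i <;> decide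

/-- A linear literal false at three assignments is false at their pointwise XOR (the falsifying set
of a linear clause is an affine subspace of `𝔽₂ⁿ`). [Itsykson–Sokolov 2020, §2] [cite: ItsyksonSokolov2020, §2] -/
theorem linLit_eval_xor3_eq_false {x y z : ℕ → Bool} {l : LinLit}
    (hx : LinLit.eval x l = false) (hy : LinLit.eval y l = false) (hz : LinLit.eval z l = false) :
    LinLit.eval (fun i => xor (xor (x i) (y i)) (z i)) l = false := by
  rcases l with ⟨f, b⟩
  rw [← Bool.not_not b, linLit_eval_not, Bool.not_eq_false'] at hx hy hz ⊢
  rw [linLit_eval_eq_true_iff_sum] at hx hy hz ⊢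
  rw [sum_xor3, hx, hy, hz]
  cases b <;> decide

/-- A linear clause false at three assignments is false at their pointwise XOR.
[Itsykson–Sokolov 2020, §2] [cite: ItsyksonSokolov2020, §2] -/
theorem linClause_eval_xor3_eq_false {x y z : ℕ → Bool} {C : LinClause}
    (hx : C.eval x = false) (hy : C.eval y = false) (hz : C.eval z = false) :
    C.eval (fun i => xor (xor (x i) (y i)) (z i)) = false := by
  rw [linClause_eval_eq_false_iff'] at hx hy hz ⊢
  exact fun l hl => linLit_eval_xor3_eq_false (hx l hl) (hy l hl) (hz l hl)

/-- The value of a literal at the pointwise XOR of three assignments, `ZMod 2` form. [folklore] -/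
private theorem linLit_eval_xor3_iff {x y z : ℕ → Bool} (f : Finset ℕ) (b : Bool) :
    LinLit.eval (fun i => xor (xor (x i) (y i)) (z i)) (f, b) = true ↔
      ∑ i ∈ f, (if x i = true then (1 : ZMod 2) else 0) +
        ∑ i ∈ f, (if y i = true then (1 : ZMod 2) else 0) +
        ∑ i ∈ f, (if z i = true then (1 : ZMod 2) else 0) = (if b = true then 1 else 0) := by
  rw [linLit_eval_eq_true_iff_sum, sum_xor3]

/-! ### The three-candidates lemma (resolution step of the space argument) -/

/-- A linear clause with a true literal is true. [Itsykson–Sokolov 2020, §2]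
[cite: ItsyksonSokolov2020, §2] -/
theorem linClause_eval_eq_true_of_mem {σ : ℕ → Bool} {C : LinClause} {l : LinLit}
    (hl : l ∈ C) (h : LinLit.eval σ l = true) : C.eval σ = true := by
  unfold LinClause.eval
  simp only [decide_eq_true_eq]
  exact ⟨l, hl, h⟩

/-- If `C ∨ l` is true and `C` is false at `σ`, then `l` is true (helper). [folklore] -/
private theorem linLit_eval_of_insert {σ : ℕ → Bool} {C : LinClause} {l : LinLit}
    (h : LinClause.eval σ (insert l C) = true) (hC : C.eval σ = false) :
    LinLit.eval σ l = true := by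
  rw [LinClause.eval_insert, hC, Bool.or_false] at h
  exact h

/-- A sub-clause of a false clause is false (helper). [folklore] -/
private theorem linClause_eval_eq_false_of_subset {σ : ℕ → Bool} {C D : LinClause} (h : C ⊆ D)
    (hD : D.eval σ = false) : C.eval σ = false := by
  rw [linClause_eval_eq_false_iff'] at hD ⊢
  exact fun l hl => hD l (h hl)

/-- **Three candidates.** If the single equation `e₁ = (h₁ = γ₁)` implies the linear clause
`C ∨ (f = 0)` and `e₂ = (h₂ = γ₂)` implies `D ∨ (f = 1)`, then one of `e₁`, `e₂`, `e₁ + e₂ =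
(h₁ + h₂ = γ₁ + γ₂)` implies the resolvent `C ∨ D`. (If all three failed, pick falsifiers `x, y, z`
of `C ∨ D` satisfying `e₁`, `e₂`, `e₁ + e₂` respectively; then `f(x) = 0`, `f(y) = 1`, `h₂(x) ≠ γ₂`,
`h₁(y) ≠ γ₁`, and either `z` satisfies both `e₁, e₂` — forcing `f(z) = 0` and `= 1` — or neither,
in which case the affine combination `x + y + z` falsifies `C ∨ D` and satisfies both.) This is the
resolution case of [Gryaznov–Ovcharov–Riazanov 2024, Lemma 9], made to work for one tracked
EQUATION per clause rather than one tracked LITERAL. [cite: GryaznovOvcharovRiazanov2024, Lemma 9] -/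
theorem exists_imp_resolvent_of_imp (h₁ h₂ f : Finset ℕ) (γ₁ γ₂ : Bool) (C D : LinClause)
    (he₁ : ∀ σ : ℕ → Bool, LinLit.eval σ (h₁, γ₁) = true → LinClause.eval σ (insert (f, false) C) = true)
    (he₂ : ∀ σ : ℕ → Bool, LinLit.eval σ (h₂, γ₂) = true → LinClause.eval σ (insert (f, true) D) = true) :
    (∀ σ : ℕ → Bool, LinLit.eval σ (h₁, γ₁) = true → LinClause.eval σ (C ∪ D) = true) ∨
    (∀ σ : ℕ → Bool, LinLit.eval σ (h₂, γ₂) = true → LinClause.eval σ (C ∪ D) = true) ∨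
    (∀ σ : ℕ → Bool, LinLit.eval σ (symmDiff h₁ h₂, xor γ₁ γ₂) = true →
      LinClause.eval σ (C ∪ D) = true) := by
  by_contra hcon
  simp only [not_or, not_forall, exists_prop, Bool.not_eq_true] at hcon
  obtain ⟨⟨x, hx₁, hxQ⟩, ⟨y, hy₂, hyQ⟩, ⟨z, hz₁₂, hzQ⟩⟩ := hcon
  -- notation: the parities of `x`, `y`, `z` on a form, as elements of `ZMod 2`, kept opaque
  obtain ⟨X, hX⟩ : ∃ X : Finset ℕ → ZMod 2,
      ∀ g, X g = ∑ i ∈ g, (if x i = true then (1 : ZMod 2) else 0) := ⟨_, fun _ => rfl⟩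
  obtain ⟨Y, hY⟩ : ∃ Y : Finset ℕ → ZMod 2,
      ∀ g, Y g = ∑ i ∈ g, (if y i = true then (1 : ZMod 2) else 0) := ⟨_, fun _ => rfl⟩
  obtain ⟨Z, hZ⟩ : ∃ Z : Finset ℕ → ZMod 2,
      ∀ g, Z g = ∑ i ∈ g, (if z i = true then (1 : ZMod 2) else 0) := ⟨_, fun _ => rfl⟩
  obtain ⟨bz, hbz⟩ : ∃ bz : Bool → ZMod 2,
      ∀ b, bz b = (if b = true then (1 : ZMod 2) else 0) := ⟨_, fun _ => rfl⟩
  have evX : ∀ g b, LinLit.eval x (g, b) = true ↔ X g = bz b := fun g b => by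
    rw [linLit_eval_eq_true_iff_sum, hX, hbz]
  have evY : ∀ g b, LinLit.eval y (g, b) = true ↔ Y g = bz b := fun g b => by
    rw [linLit_eval_eq_true_iff_sum, hY, hbz]
  have evZ : ∀ g b, LinLit.eval z (g, b) = true ↔ Z g = bz b := fun g b => by
    rw [linLit_eval_eq_true_iff_sum, hZ, hbz]
  have two : ∀ u : ZMod 2, u = 0 ∨ u = 1 := by decide
  have bz0 : bz false = 0 := by rw [hbz]; rfl
  have bz1 : bz true = 1 := by rw [hbz]; rfl
  have bzval : ∀ b : Bool, bz b = 0 ∨ bz b = 1 := by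
    intro b; cases b
    · exact Or.inl bz0
    · exact Or.inr bz1
  -- every element of `ZMod 2` is some `bz b`
  have exists_bz : ∀ u : ZMod 2, ∃ b : Bool, bz b = u := by
    intro u
    rcases two u with rfl | rfl
    · exact ⟨false, bz0⟩
    · exact ⟨true, bz1⟩
  -- `C` and `D` are false at `x`, `y`, `z`
  have hxC := linClause_eval_eq_false_of_subset Finset.subset_union_left hxQ
  have hxD := linClause_eval_eq_false_of_subset Finset.subset_union_right hxQ
  have hyC := linClause_eval_eq_false_of_subset Finset.subset_union_left hyQ
  have hyD := linClause_eval_eq_false_of_subset Finset.subset_union_right hyQ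
  have hzC := linClause_eval_eq_false_of_subset Finset.subset_union_left hzQ
  have hzD := linClause_eval_eq_false_of_subset Finset.subset_union_right hzQ
  -- `f(x) = 0`, `f(y) = 1`
  have hfx : X f = 0 := by
    have := linLit_eval_of_insert (he₁ x hx₁) hxC
    rw [evX, bz0] at this
    exact this
  have hfy : Y f = 1 := by
    have := linLit_eval_of_insert (he₂ y hy₂) hyD
    rw [evY, bz1] at this
    exact this
  -- `e₂` is false at `x` and `e₁` is false at `y`
  have hx₂ : X h₂ ≠ bz γ₂ := by
    intro hcontra
    have := linLit_eval_of_insert (he₂ x ((evX h₂ γ₂).2 hcontra)) hxD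
    rw [evX, bz1, hfx] at this
    exact absurd this (by decide)
  have hy₁ : Y h₁ ≠ bz γ₁ := by
    intro hcontra
    have := linLit_eval_of_insert (he₁ y ((evY h₁ γ₁).2 hcontra)) hyC
    rw [evY, bz0, hfy] at this
    exact absurd this (by decide)
  have hx₁' : X h₁ = bz γ₁ := (evX h₁ γ₁).1 hx₁
  have hy₂' : Y h₂ = bz γ₂ := (evY h₂ γ₂).1 hy₂
  -- additivity facts in `ZMod 2`
  have bz_xor : ∀ a b : Bool, bz (xor a b) = bz a + bz b := by
    intro a b; rw [hbz, hbz, hbz]; cases a <;> cases b <;> decide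
  -- the value of `e₁ + e₂` at `z`: `Z h₁ + Z h₂ = bz γ₁ + bz γ₂`
  have hz' : Z h₁ + Z h₂ = bz γ₁ + bz γ₂ := by
    obtain ⟨a, ha⟩ := exists_bz (Z h₁)
    obtain ⟨b, hb⟩ := exists_bz (Z h₂)
    have hab := linLit_eval_symmDiff z h₁ h₂ a b ((evZ h₁ a).2 ha.symm) ((evZ h₂ b).2 hb.symm)
    rw [evZ] at hab hz₁₂
    have hh := hab.symm.trans hz₁₂
    rw [bz_xor, bz_xor, ha, hb] at hh
    exact hh
  -- the flipped value: `u ≠ bz b` means `u = bz b + 1`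
  have ne_iff : ∀ (u : ZMod 2) (b : Bool), u ≠ bz b ↔ u = bz b + 1 := by
    intro u b
    rcases two u with rfl | rfl <;> rcases bzval b with h | h <;> rw [h] <;> decide
  by_cases hz1 : Z h₁ = bz γ₁
  · -- then `Z h₂ = bz γ₂` too: both equations hold at `z`, forcing `f(z) = 0` and `f(z) = 1`
    have hz2 : Z h₂ = bz γ₂ := by
      rw [hz1] at hz'
      exact add_left_cancel hz'
    have f0 := linLit_eval_of_insert (he₁ z ((evZ h₁ γ₁).2 hz1)) hzC
    have f1 := linLit_eval_of_insert (he₂ z ((evZ h₂ γ₂).2 hz2)) hzD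
    rw [LinLit.eval_true_eq_not, f0] at f1
    exact absurd f1 (by decide)
  · -- otherwise neither holds at `z`; then both hold at `w = x + y + z`, which falsifies `C ∨ D`
    have hz1' : Z h₁ = bz γ₁ + 1 := (ne_iff _ _).1 hz1
    have hz2' : Z h₂ = bz γ₂ + 1 := by
      rw [hz1'] at hz'
      have : Z h₂ = bz γ₁ + bz γ₂ - (bz γ₁ + 1) := by rw [← hz']; ring
      rw [this]
      have h11 : ∀ u v : ZMod 2, u + v - (u + 1) = v + 1 := by decide
      exact h11 _ _
    have hwQ : LinClause.eval (fun i => xor (xor (x i) (y i)) (z i)) (C ∪ D) = false :=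
      linClause_eval_xor3_eq_false hxQ hyQ hzQ
    have hwC := linClause_eval_eq_false_of_subset Finset.subset_union_left hwQ
    have hwD := linClause_eval_eq_false_of_subset Finset.subset_union_right hwQ
    have add3 : ∀ u : ZMod 2, u + (u + 1) + (u + 1) = u := by decide
    -- `e₁` holds at `w`: `X h₁ + Y h₁ + Z h₁ = γ₁ + (γ₁+1) + (γ₁+1) = γ₁`
    have e1w : LinLit.eval (fun i => xor (xor (x i) (y i)) (z i)) (h₁, γ₁) = true := by
      rw [linLit_eval_xor3_iff, ← hX, ← hY, ← hZ, ← hbz, hx₁', (ne_iff _ _).1 hy₁, hz1']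
      exact add3 _
    -- `e₂` holds at `w`: `X h₂ + Y h₂ + Z h₂ = (γ₂+1) + γ₂ + (γ₂+1) = γ₂`
    have e2w : LinLit.eval (fun i => xor (xor (x i) (y i)) (z i)) (h₂, γ₂) = true := by
      rw [linLit_eval_xor3_iff, ← hX, ← hY, ← hZ, ← hbz, hy₂', (ne_iff _ _).1 hx₂, hz2']
      have : ∀ u : ZMod 2, (u + 1) + u + (u + 1) = u := by decide
      exact this _
    have f0 := linLit_eval_of_insert (he₁ _ e1w) hwC
    have f1 := linLit_eval_of_insert (he₂ _ e2w) hwD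
    rw [LinLit.eval_true_eq_not, f0] at f1
    exact absurd f1 (by decide)

end Literature.Computability.MetaComplexity
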